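import Literature.Geometry.Kaehler.ComplexTorusEquivariantEndomorphismAlgebraCommutantAnalyticCriterion
import HarnessLib

/-!
# The analytic character in the equality case: `⟨χ, χ_a⟩ = ⟨χ, χ_r⟩` on the holomorphic isotypic components and
# `0` on the others, and the dimension formula `dim X = Σ_{χ holomorphic} χ(1) ⟨χ, χ_r⟩`

Layer `Literature/Geometry/Kaehler`, namespace `Literature.Geometry.Kaehler.ComplexTorus`; lane `lit-hodgefound`
(Track 2 foundations library), Layer A2, row «A2-26(do)» (self-proposed 2026-08-27, prover seat `lit-hodgefound-p10`,
generation 23, FILE 9).  Sequel of FILE 8 `…CommutantAnalyticCriterion.lean` (the complexified period map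
`cxPeriod`, THE BRIDGE `asAlgebraHom_tangentRep_eq_zero_iff`: `ρ_a(x) = 0 ⟺ J_ℂ ρ_ℂ(x) = -i ρ_ℂ(x)`,
`asAlgebraHom_tangentRep_charIdempotent_star_eq_zero_iff`, `asAlgebraHom_tangentRep_charIdempotent_eq_zero_iff_classInner`
(`ρ_a(e_χ) = 0 ⟺ ⟨χ, χ_a⟩ = 0`), `classInner_star_left_eq_zero_iff`, THE ANALYTIC CRITERION
`endAlgRatG_eq_centralizer_iff_forall_classInner`), of FILE 4 (`jMatrix_mul_charIdempotent_eq_I_smul_or`: in the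
equality case `J_ℂ P_χ = ±i P_χ`) and of generation 17's `ComplexTorusTangentSpaceGroupAction.lean`
(`tangentRep ρ`, **`ratCast_trace_eq_trace_add_conj`: `χ_r = χ_a + χ̄_a`** — (2.6) on characters).  CONSUMED BY NAME:
p38's `moduleChar` (the character `Ξ_M` of a `ℚ[G]`-module, `ComplexTorusGroupAlgebraRationalCharacters`),
`RatRepModule ρ` / `RatRepModule.toFun` / `RatRepModule.smul_def` (gen-16), `charIdempotent`, `sum_charIdempotent`,
`irrChars_finite_holds`, `classInner`, `classInner_add_left`, `classInner_comm`, `Representation.asAlgebraHom_charIdempotent`,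
`trace_isotypicProj`, `IsIrrChar.star`.

## The mathematics

For a complex torus `X` with an action `ρ` of the finite group `G` let `χ_r = Ξ_{ρ_r}` be the character of the
rational representation `ρ_r = H₁(X,ℚ)` (`χ_r(g) = Tr ρ(g)`) and `χ_a` that of the analytic representation `ρ_a` on
`T_0X`; `χ_r = χ_a + \overline{χ_a}` (`ρ_r ⊗ 1 ≃ ρ_a ⊕ \overline{ρ_a}`, (2.6)), so `⟨χ, χ_r⟩ = ⟨χ, χ_a⟩ + ⟨χ, \overline{χ_a}⟩`
for every `χ`, and always `dim X = χ_a(1) = Σ_{χ ∈ Irr(G)} χ(1) ⟨χ, χ_a⟩`.  If the `χ`-isotypic component of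
`H₁(X,ℂ)` is holomorphic (`J_ℂ P_χ = i P_χ`, i.e. it lies in `T_0X`), then `⟨χ̄, χ_a⟩ = 0`, i.e. `⟨χ, \overline{χ_a}⟩ = 0`
and `⟨χ, χ_a⟩ = ⟨χ, χ_r⟩`; if it is antiholomorphic, `⟨χ, χ_a⟩ = 0`.  In the EQUALITY CASE
`End_ℚ^G(X) = End_{ℚ[G]}(H₁(X,ℚ))` every component is one or the other (FILE 4), hence THE ANALYTIC CHARACTER IS
DETERMINED BY THE RATIONAL ONE AND THE HODGE TYPES: `⟨χ, χ_a⟩ = ⟨χ, χ_r⟩` or `0`, and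
**`dim X = Σ_{χ ∈ Irr(G), J_ℂ P_χ = i P_χ} χ(1) ⟨χ, χ_r⟩`**.

## Sources, VERBATIM (held texts)

* H. Lange, R. E. Rodríguez, *Decomposition of Jacobians by Prym Varieties*, LNM 2310 (2022; held
  `book:lange2022-decomposition-jacobians-by-prym-varieties`), §2.2 p0029: "(2.6) `ρ_r ⊗ 1 ≃ ρ_a ⊕ \overline{ρ_a}`";
  §2.9.1 p0046, Prop. 2.9.3 (proof): "comparing dimensions"; §2.9.2 p0046: "Let `V` be a complex representation of
  a finite group `G` […] `V = ⊕ V_i^{n_i}`" (Lemma 2.9.4, applied to the tangent space).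
* H. Lange, *Abelian Varieties over the Complex Numbers* (2023), §1.1.2 Prop. 1.1.9 (`ρ_r ⊗ 1 ≃ ρ_a ⊕ \overline{ρ_a}`),
  §2.4.1 Cor. 2.4.4 (b) (`Tr_r(f) = 2 Re Tr_a(f)`).
* I. M. Isaacs, *Character Theory of Finite Groups* (1976; held), Cor. 10.2 (c) (the character `Ξ_M` of an
  `F[G]`-module), Thm. 2.12 and Ch. 3 p. 36 (traces of `ρ(e_χ)`); J.-P. Serre, *Linear Representations of Finite
  Groups*, §2.6 Thm. 8 (`tr P_χ = χ(1)⟨χ, χ_V⟩`), §2.3 (decomposition of a character).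
* I. Dolgachev, Yu. G. Zarhin, *Endomorphisms of Complex Abelian Varieties* (2024; held
  `paper:galaxy-pdf-8712177384607648460`), §2.2 p0035–p0036, Remark 2.17 and Thm. 2.18 (the equality case).

## What is proved (theorems only; NO definition, NO named fact, no `sorry`)

`X = E/Φ(ℤ^ι)`, `E` finite-dimensional over `ℂ`, `G : Type` finite, `ρ : G →* End_ℚ(X)`, `χ_r = moduleChar G (RatRepModule ρ)`,
`χ_a = (tangentRep ρ).character`, `P_χ = complexGroupAlgebraRep ρ (charIdempotent χ)`, `J_ℂ = (jMatrix Φ) ⊗ ℂ`,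
`T = (irrChars_finite_holds G).toFinset`.
* §1 `toModuleEnd_ratRepModule_of` and **`moduleChar_ratRepModule_apply`** (`χ_r(g) = Tr ρ(g)`),
  **`moduleChar_ratRepModule_eq_character_add_star`** (`χ_r = χ_a + \overline{χ_a}`), `classInner_add_right`,
  **`classInner_moduleChar_ratRepModule`** (`⟨χ, χ_r⟩ = ⟨χ, χ_a⟩ + ⟨χ, \overline{χ_a}⟩`).
* §2 `trace_asAlgebraHom_tangentRep_charIdempotent` (`tr ρ_a(e_χ) = χ(1)⟨χ, χ_a⟩`),
  **`natCast_finrank_eq_sum_classInner_tangentRep`** (`dim X = Σ_{χ ∈ Irr(G)} χ(1)⟨χ, χ_a⟩`, any action).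
* §3 Hodge types: **`classInner_star_tangentRep_eq_zero_of_jMatrix_mul_eq_I_smul`** (holomorphic component ⟹
  `⟨χ, \overline{χ_a}⟩ = 0`) and **`classInner_tangentRep_eq_classInner_moduleChar_of_jMatrix_mul_eq_I_smul`**
  (`⟹ ⟨χ, χ_a⟩ = ⟨χ, χ_r⟩`); **`classInner_tangentRep_eq_zero_of_jMatrix_mul_eq_neg_I_smul`** (antiholomorphic ⟹
  `⟨χ, χ_a⟩ = 0`) and `classInner_star_tangentRep_eq_classInner_moduleChar_of_jMatrix_mul_eq_neg_I_smul`.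
* §4 THE EQUALITY CASE: **`classInner_tangentRep_eq_or_of_endAlgRatG_eq_centralizer`** (`⟨χ, χ_a⟩ = ⟨χ, χ_r⟩` with
  `⟨χ, \overline{χ_a}⟩ = 0`, or `⟨χ, χ_a⟩ = 0` with `⟨χ, \overline{χ_a}⟩ = ⟨χ, χ_r⟩`), and THE DIMENSION FORMULA
  **`natCast_finrank_eq_sum_filter_of_endAlgRatG_eq_centralizer`: `dim X = Σ_{χ ∈ Irr(G), J_ℂ P_χ = i P_χ} χ(1)⟨χ, χ_r⟩`.**

## References

* [LangeRodriguez2022] H. Lange, R. E. Rodríguez, *Decomposition of Jacobians by Prym Varieties*, LNM 2310 (2022),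
  §2.2 (2.6); §2.9.1 Prop. 2.9.3; §2.9.2 Lemma 2.9.4.
* [Lange2023AbelianVarietiesComplex] H. Lange, *Abelian Varieties over the Complex Numbers* (2023), §1.1.2
  Prop. 1.1.9; §2.4.1 Cor. 2.4.4 (b).
* [Isaacs1976] I. M. Isaacs, *Character Theory of Finite Groups* (1976), Cor. 10.2, Thm. 2.12, Ch. 3 p. 36.
* [SerreLinearRepresentations1977] J.-P. Serre, *Linear Representations of Finite Groups* (1977), §2.3, §2.6 Thm. 8.
* [DolgachevZarhin2024] I. Dolgachev, Yu. G. Zarhin, *Endomorphisms of Complex Abelian Varieties* (2024), §2.2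
  Remark 2.17, Thm. 2.18.
-/

noncomputable section

open Module Function
open scoped Matrix

namespace Literature.Geometry.Kaehler

namespace ComplexTorus

open Literature.RepresentationTheory.FiniteGroups

universe u

section ClassInner

variable {G : Type} [Group G] [Fintype G]

/-- The scalar product is additive in the second variable. [cite: SerreLinearRepresentations1977, §2.3 (bilinearity of `⟨ , ⟩`)] -/
theorem classInner_add_right (φ ψ ψ' : G → ℂ) : classInner φ (ψ + ψ') = classInner φ ψ + classInner φ ψ' := by
  rw [classInner_comm, classInner_add_left, classInner_comm ψ, classInner_comm ψ']

end ClassInner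

/-! ### §1 The rational character `χ_r = χ_a + \overline{χ_a}` -/

section RationalCharacter

variable {ι : Type u} [Fintype ι] [DecidableEq ι] {E : Type*} [NormedAddCommGroup E] [NormedSpace ℂ E]
  {Φ : (ι → ℝ) ≃L[ℝ] E} {G : Type} [Group G] [Fintype G] (ρ : G →* endAlgRat Φ)

omit [Fintype G] in
/-- `g` acts on `ρ_r = RatRepModule ρ` by the matrix `ρ(g)` (conjugated by the tautological `ρ_r ≃ ℚ^ι`).
[cite: LangeRodriguez2022, §2.9.1 (2.26), p0042] -/
theorem toModuleEnd_ratRepModule_of (g : G) :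
    Module.toModuleEnd ℚ (RatRepModule ρ) (MonoidAlgebra.of ℚ G g) =
      (RatRepModule.toFun ρ).symm.conj (Matrix.toLin' ((ρ g : endAlgRat Φ) : Matrix ι ι ℚ)) := by
  refine LinearMap.ext fun v ↦ (RatRepModule.toFun ρ).injective ?_
  rw [toModuleEnd_of_apply, RatRepModule.smul_def, groupAlgebraRep_of, LinearEquiv.conj_apply_apply,
    LinearEquiv.symm_symm, LinearEquiv.apply_symm_apply, Matrix.toLin'_apply]

omit [Fintype G] in
/-- **`χ_r(g) = Tr ρ(g)`**: the character of the rational representation `ρ_r = H₁(X,ℚ)` is the trace of the rational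
representation. [cite: Isaacs1976, Cor. 10.2 (c) (the character `Ξ_M`), p0159] [cite: LangeRodriguez2022, §2.9.1 (2.26) and Prop. 2.9.3, p0042, p0046] -/
theorem moduleChar_ratRepModule_apply (g : G) :
    moduleChar G (RatRepModule ρ) g = ((((ρ g : endAlgRat Φ) : Matrix ι ι ℚ).trace : ℚ) : ℂ) := by
  rw [moduleChar_apply, toModuleEnd_ratRepModule_of, LinearMap.trace_conj', Matrix.trace_toLin'_eq]

variable [FiniteDimensional ℂ E]

omit [Fintype G] in
/-- **`χ_r = χ_a + \overline{χ_a}`** — "`ρ_r ⊗ 1 ≃ ρ_a ⊕ \overline{ρ_a}`" (2.6) on characters (generation 17's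
`ratCast_trace_eq_trace_add_conj`). [cite: LangeRodriguez2022, §2.2 (2.6), p0029] [cite: Lange2023AbelianVarietiesComplex, §1.1.2 Prop. 1.1.9 and §2.4.1 Cor. 2.4.4 (b)] -/
theorem moduleChar_ratRepModule_eq_character_add_star :
    moduleChar G (RatRepModule ρ) = (tangentRep ρ).character + star (tangentRep ρ).character := by
  funext g
  rw [moduleChar_ratRepModule_apply, ratCast_trace_eq_trace_add_conj, Pi.add_apply, Pi.star_apply, Complex.star_def]
  rfl

/-- **`⟨χ, χ_r⟩ = ⟨χ, χ_a⟩ + ⟨χ, \overline{χ_a}⟩`** for every class function `χ`.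
[cite: LangeRodriguez2022, §2.2 (2.6), p0029] [cite: SerreLinearRepresentations1977, §2.3] -/
theorem classInner_moduleChar_ratRepModule (χ : G → ℂ) :
    classInner χ (moduleChar G (RatRepModule ρ)) =
      classInner χ (tangentRep ρ).character + classInner χ (star (tangentRep ρ).character) := by
  rw [moduleChar_ratRepModule_eq_character_add_star, classInner_add_right]

end RationalCharacter

/-! ### §2 `dim X = Σ_χ χ(1) ⟨χ, χ_a⟩` -/

section Dimension

variable {ι : Type u} [Fintype ι] [DecidableEq ι] {E : Type*} [NormedAddCommGroup E] [NormedSpace ℂ E]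
  [FiniteDimensional ℂ E] {Φ : (ι → ℝ) ≃L[ℝ] E} {G : Type} [Group G] [Fintype G] (ρ : G →* endAlgRat Φ)

/-- `tr ρ_a(e_χ) = χ(1) ⟨χ, χ_a⟩` (`ρ_a(e_χ)` is the isotypic projector). [cite: SerreLinearRepresentations1977, §2.6 Thm. 8] [cite: Isaacs1976, Thm. 2.12 and Ch. 3 p. 36, p0024, p0040] -/
theorem trace_asAlgebraHom_tangentRep_charIdempotent (χ : G → ℂ) :
    LinearMap.trace ℂ E ((tangentRep ρ).asAlgebraHom (charIdempotent χ)) =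
      χ 1 * classInner χ (tangentRep ρ).character := by
  rw [Representation.asAlgebraHom_charIdempotent, trace_isotypicProj]

/-- **`dim X = Σ_{χ ∈ Irr(G)} χ(1) ⟨χ, χ_a⟩`** for every action (`Σ_χ ρ_a(e_χ) = ρ_a(1) = 1`, take traces): the
decomposition `T_0X = ⊕_i V_i^{n_i}` of Lemma 2.9.4 counted. [cite: LangeRodriguez2022, §2.9.2 Lemma 2.9.4 (`V = ⊕ V_i^{n_i}`), p0046]
[cite: Isaacs1976, Thm. 2.13 (`1 = Σ e_i`), p0025] [cite: SerreLinearRepresentations1977, §2.6 Thm. 8] -/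
theorem natCast_finrank_eq_sum_classInner_tangentRep :
    (finrank ℂ E : ℂ) =
      ∑ χ ∈ (irrChars_finite_holds G).toFinset, χ 1 * classInner χ (tangentRep ρ).character := by
  have h1 : ∑ χ ∈ (irrChars_finite_holds G).toFinset, (tangentRep ρ).asAlgebraHom (charIdempotent χ) = LinearMap.id := by
    rw [← map_sum, sum_charIdempotent, map_one, Module.End.one_eq_id]
  rw [← LinearMap.trace_id, ← h1, map_sum]
  exact Finset.sum_congr rfl fun χ _ ↦ trace_asAlgebraHom_tangentRep_charIdempotent ρ χ

end Dimension

/-! ### §3 Holomorphic and antiholomorphic isotypic components -/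

section HodgeTypes

variable {ι : Type u} [Fintype ι] [DecidableEq ι] {E : Type*} [NormedAddCommGroup E] [NormedSpace ℂ E]
  [FiniteDimensional ℂ E] {Φ : (ι → ℝ) ≃L[ℝ] E} {G : Type} [Group G] [Fintype G] (ρ : G →* endAlgRat Φ)

/-- **A HOLOMORPHIC isotypic component (`J_ℂ P_χ = i P_χ`, it lies in `T_0X`) contributes nothing to `\overline{ρ_a}`:
`⟨χ, \overline{χ_a}⟩ = 0`.** [cite: LangeRodriguez2022, §2.2 (2.6), p0029] [cite: Lange2023AbelianVarietiesComplex, §1.1.2 Prop. 1.1.9 and §7.1.1 Prop. 7.1.1] -/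
theorem classInner_star_tangentRep_eq_zero_of_jMatrix_mul_eq_I_smul {χ : G → ℂ} (hχ : IsIrrChar G χ)
    (h : (jMatrix Φ).map ((↑) : ℝ → ℂ) * complexGroupAlgebraRep ρ (charIdempotent χ) =
      Complex.I • complexGroupAlgebraRep ρ (charIdempotent χ)) :
    classInner χ (star (tangentRep ρ).character) = 0 := by
  rw [← classInner_star_left_eq_zero_iff, ← asAlgebraHom_tangentRep_charIdempotent_eq_zero_iff_classInner ρ hχ.star]
  exact (asAlgebraHom_tangentRep_charIdempotent_star_eq_zero_iff ρ χ).2 h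

/-- **Holomorphic component: `⟨χ, χ_a⟩ = ⟨χ, χ_r⟩`** (all of the `χ`-isotypic part of `H₁(X,ℂ)` is in `T_0X`).
[cite: LangeRodriguez2022, §2.2 (2.6) and §2.9.1 Prop. 2.9.3 (proof: "comparing dimensions"), p0029, p0046] -/
theorem classInner_tangentRep_eq_classInner_moduleChar_of_jMatrix_mul_eq_I_smul {χ : G → ℂ} (hχ : IsIrrChar G χ)
    (h : (jMatrix Φ).map ((↑) : ℝ → ℂ) * complexGroupAlgebraRep ρ (charIdempotent χ) =
      Complex.I • complexGroupAlgebraRep ρ (charIdempotent χ)) :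
    classInner χ (tangentRep ρ).character = classInner χ (moduleChar G (RatRepModule ρ)) := by
  rw [classInner_moduleChar_ratRepModule, classInner_star_tangentRep_eq_zero_of_jMatrix_mul_eq_I_smul ρ hχ h, add_zero]

/-- **An ANTIHOLOMORPHIC isotypic component (`J_ℂ P_χ = -i P_χ`) contributes nothing to `ρ_a`: `⟨χ, χ_a⟩ = 0`.**
[cite: LangeRodriguez2022, §2.2 (2.6), p0029] [cite: Lange2023AbelianVarietiesComplex, §1.1.2 Prop. 1.1.9 and §7.1.1 Prop. 7.1.1] -/
theorem classInner_tangentRep_eq_zero_of_jMatrix_mul_eq_neg_I_smul {χ : G → ℂ} (hχ : IsIrrChar G χ)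
    (h : (jMatrix Φ).map ((↑) : ℝ → ℂ) * complexGroupAlgebraRep ρ (charIdempotent χ) =
      -(Complex.I • complexGroupAlgebraRep ρ (charIdempotent χ))) :
    classInner χ (tangentRep ρ).character = 0 :=
  (asAlgebraHom_tangentRep_charIdempotent_eq_zero_iff_classInner ρ hχ).1
    ((asAlgebraHom_tangentRep_eq_zero_iff ρ _).2 h)

/-- **Antiholomorphic component: `⟨χ, \overline{χ_a}⟩ = ⟨χ, χ_r⟩`.** [cite: LangeRodriguez2022, §2.2 (2.6), p0029] -/
theorem classInner_star_tangentRep_eq_classInner_moduleChar_of_jMatrix_mul_eq_neg_I_smul {χ : G → ℂ}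
    (hχ : IsIrrChar G χ)
    (h : (jMatrix Φ).map ((↑) : ℝ → ℂ) * complexGroupAlgebraRep ρ (charIdempotent χ) =
      -(Complex.I • complexGroupAlgebraRep ρ (charIdempotent χ))) :
    classInner χ (star (tangentRep ρ).character) = classInner χ (moduleChar G (RatRepModule ρ)) := by
  rw [classInner_moduleChar_ratRepModule, classInner_tangentRep_eq_zero_of_jMatrix_mul_eq_neg_I_smul ρ hχ h, zero_add]

end HodgeTypes

/-! ### §4 The equality case: `χ_a` from `χ_r` and the Hodge types; the dimension formula -/

section Equality

variable {ι : Type u} [Fintype ι] [DecidableEq ι] {E : Type*} [NormedAddCommGroup E] [NormedSpace ℂ E]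
  [FiniteDimensional ℂ E] {Φ : (ι → ℝ) ≃L[ℝ] E} {G : Type} [Group G] [Fintype G] (ρ : G →* endAlgRat Φ)

/-- **In the equality case the analytic multiplicities are determined by the rational ones and the Hodge types**:
for every `χ ∈ Irr(G)` either `⟨χ, χ_a⟩ = ⟨χ, χ_r⟩` and `⟨χ, \overline{χ_a}⟩ = 0` (holomorphic component), or
`⟨χ, χ_a⟩ = 0` and `⟨χ, \overline{χ_a}⟩ = ⟨χ, χ_r⟩` (antiholomorphic component).
[cite: DolgachevZarhin2024, §2.2 Remark 2.17 and Thm. 2.18, p0035–p0036] [cite: LangeRodriguez2022, §2.2 (2.6) and §2.9.1 Prop. 2.9.3, p0029, p0046] -/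
theorem classInner_tangentRep_eq_or_of_endAlgRatG_eq_centralizer
    (h : endAlgRatG Φ ρ = Subalgebra.centralizer ℚ (Set.range fun g : G ↦ ((ρ g : endAlgRat Φ) : Matrix ι ι ℚ)))
    {χ : G → ℂ} (hχ : IsIrrChar G χ) :
    (classInner χ (tangentRep ρ).character = classInner χ (moduleChar G (RatRepModule ρ)) ∧
        classInner χ (star (tangentRep ρ).character) = 0) ∨
      (classInner χ (tangentRep ρ).character = 0 ∧
        classInner χ (star (tangentRep ρ).character) = classInner χ (moduleChar G (RatRepModule ρ))) := by
  rcases jMatrix_mul_charIdempotent_eq_I_smul_or ρ h hχ with h1 | h1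
  · exact Or.inl ⟨classInner_tangentRep_eq_classInner_moduleChar_of_jMatrix_mul_eq_I_smul ρ hχ h1,
      classInner_star_tangentRep_eq_zero_of_jMatrix_mul_eq_I_smul ρ hχ h1⟩
  · rw [neg_smul] at h1
    exact Or.inr ⟨classInner_tangentRep_eq_zero_of_jMatrix_mul_eq_neg_I_smul ρ hχ h1,
      classInner_star_tangentRep_eq_classInner_moduleChar_of_jMatrix_mul_eq_neg_I_smul ρ hχ h1⟩

/-- **THE DIMENSION FORMULA OF THE EQUALITY CASE: `dim X = Σ_{χ ∈ Irr(G), J_ℂ P_χ = i P_χ} χ(1) ⟨χ, χ_r⟩`** — the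
dimension of `X` read off from the rational representation `H₁(X,ℚ)` and the set of holomorphic isotypic components
(the "CM type"); the terms with `P_χ = 0` contribute `⟨χ, χ_r⟩ = 0`. [cite: DolgachevZarhin2024, §2.2 Thm. 2.18 ("`B` of dimension `(ℓ - 1)/2`"), p0036]
[cite: LangeRodriguez2022, §2.9.1 Prop. 2.9.3 and §2.9.2 Lemma 2.9.4, p0046] [cite: SerreLinearRepresentations1977, §2.6 Thm. 8] -/
theorem natCast_finrank_eq_sum_filter_of_endAlgRatG_eq_centralizer
    [DecidablePred fun χ : G → ℂ ↦
      (jMatrix Φ).map ((↑) : ℝ → ℂ) * complexGroupAlgebraRep ρ (charIdempotent χ) =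
        Complex.I • complexGroupAlgebraRep ρ (charIdempotent χ)]
    (h : endAlgRatG Φ ρ = Subalgebra.centralizer ℚ (Set.range fun g : G ↦ ((ρ g : endAlgRat Φ) : Matrix ι ι ℚ))) :
    (finrank ℂ E : ℂ) =
      ∑ χ ∈ (irrChars_finite_holds G).toFinset with
          (jMatrix Φ).map ((↑) : ℝ → ℂ) * complexGroupAlgebraRep ρ (charIdempotent χ) =
            Complex.I • complexGroupAlgebraRep ρ (charIdempotent χ),
        χ 1 * classInner χ (moduleChar G (RatRepModule ρ)) := by
  classical
  rw [natCast_finrank_eq_sum_classInner_tangentRep ρ, Finset.sum_filter]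
  refine Finset.sum_congr rfl fun χ hχ ↦ ?_
  have hirr : IsIrrChar G χ := (irrChars_finite_holds G).mem_toFinset.1 hχ
  split_ifs with h1
  · rw [classInner_tangentRep_eq_classInner_moduleChar_of_jMatrix_mul_eq_I_smul ρ hirr h1]
  · rcases jMatrix_mul_charIdempotent_eq_I_smul_or ρ h hirr with h2 | h2
    · exact absurd h2 h1
    · rw [neg_smul] at h2
      rw [classInner_tangentRep_eq_zero_of_jMatrix_mul_eq_neg_I_smul ρ hirr h2, mul_zero]

/-- **In the equality case `2 dim X^{hol-part}`…: the total count `Σ_χ χ(1)⟨χ, χ_r⟩ = rk Λ = 2 dim X`** splits as the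
holomorphic sum (`= dim X`, previous theorem) plus the antiholomorphic one, so **the antiholomorphic components also
account for `dim X`: `dim X = Σ_{χ ∈ Irr(G), J_ℂ P_χ = -i P_χ} χ(1) ⟨χ, χ_r⟩`.**
[cite: LangeRodriguez2022, §2.2 (2.6) (`\overline{ρ_a}` has the same dimension), p0029] [cite: DolgachevZarhin2024, §2.2 Thm. 2.18, p0036] -/
theorem natCast_finrank_eq_sum_filter_neg_of_endAlgRatG_eq_centralizer
    [DecidablePred fun χ : G → ℂ ↦
      (jMatrix Φ).map ((↑) : ℝ → ℂ) * complexGroupAlgebraRep ρ (charIdempotent χ) =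
        -(Complex.I • complexGroupAlgebraRep ρ (charIdempotent χ))]
    (h : endAlgRatG Φ ρ = Subalgebra.centralizer ℚ (Set.range fun g : G ↦ ((ρ g : endAlgRat Φ) : Matrix ι ι ℚ))) :
    (finrank ℂ E : ℂ) =
      ∑ χ ∈ (irrChars_finite_holds G).toFinset with
          (jMatrix Φ).map ((↑) : ℝ → ℂ) * complexGroupAlgebraRep ρ (charIdempotent χ) =
            -(Complex.I • complexGroupAlgebraRep ρ (charIdempotent χ)),
        χ 1 * classInner χ (moduleChar G (RatRepModule ρ)) := by
  classical
  -- `dim E = Σ_χ χ(1)⟨χ, χ̄_a⟩` as well: `⟨χ, χ̄_a⟩ = ⟨χ̄, χ_a⟩` reindexed by `χ ↦ χ̄`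
  have hstar : (finrank ℂ E : ℂ) =
      ∑ χ ∈ (irrChars_finite_holds G).toFinset, χ 1 * classInner χ (star (tangentRep ρ).character) := by
    rw [natCast_finrank_eq_sum_classInner_tangentRep ρ]
    refine Finset.sum_nbij' (fun χ ↦ star χ) (fun χ ↦ star χ) (fun χ hχ ↦ ?_) (fun χ hχ ↦ ?_)
      (fun χ _ ↦ star_star χ) (fun χ _ ↦ star_star χ) (fun χ hχ ↦ ?_)
    · exact (irrChars_finite_holds G).mem_toFinset.2 ((irrChars_finite_holds G).mem_toFinset.1 hχ).star
    · exact (irrChars_finite_holds G).mem_toFinset.2 ((irrChars_finite_holds G).mem_toFinset.1 hχ).star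
    · have hirr : IsIrrChar G χ := (irrChars_finite_holds G).mem_toFinset.1 hχ
      -- `χ(1) ⟨χ, χ_a⟩ = χ̄(1) ⟨χ̄, χ̄_a⟩`: `χ̄(1) = χ(1)` (a natural number) and `⟨χ̄, ψ̄⟩ = \overline{⟨χ, ψ⟩}` is real here
      obtain ⟨n, -, hn⟩ := hirr.exists_apply_one
      have h1 : (star χ) 1 = χ 1 := by rw [Pi.star_apply, hn, Complex.star_def, map_natCast]
      have h2 : classInner (star χ) (star (tangentRep ρ).character) = classInner χ (tangentRep ρ).character := by
        rw [classInner_star_star]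
        -- `⟨χ, χ_a⟩ = tr ρ_a(e_χ) / χ(1)` is the rank of a projector divided by `χ(1)`: a real number
        have hreal : starRingEnd ℂ (χ 1 * classInner χ (tangentRep ρ).character) =
            χ 1 * classInner χ (tangentRep ρ).character := by
          rw [← trace_asAlgebraHom_tangentRep_charIdempotent,
            (LinearMap.IsIdempotentElem.isProj_range _
              ((isIdempotentElem_charIdempotent hirr).map (tangentRep ρ).asAlgebraHom)).trace, map_natCast]
        rw [map_mul, hn, map_natCast] at hreal
        exact mul_left_cancel₀ (by rw [← hn]; exact hirr.apply_one_ne_zero) hreal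
      rw [h1, h2]
  rw [hstar, Finset.sum_filter]
  refine Finset.sum_congr rfl fun χ hχ ↦ ?_
  have hirr : IsIrrChar G χ := (irrChars_finite_holds G).mem_toFinset.1 hχ
  split_ifs with h1
  · rw [classInner_star_tangentRep_eq_classInner_moduleChar_of_jMatrix_mul_eq_neg_I_smul ρ hirr h1]
  · rcases jMatrix_mul_charIdempotent_eq_I_smul_or ρ h hirr with h2 | h2
    · rw [classInner_star_tangentRep_eq_zero_of_jMatrix_mul_eq_I_smul ρ hirr h2, mul_zero]
    · rw [neg_smul] at h2
      exact absurd h2 h1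

end Equality

end ComplexTorus

end Literature.Geometry.Kaehler
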